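import Literature.NumberTheory.Transcendental.MultipleZeta
import HarnessLib

/-!
# Multiple zeta values — proofs: depth one is Riemann's `ζ(k)`; convergence and positivity

Sibling proof file of `Literature.NumberTheory.Transcendental.MultipleZeta` (D-0014 keeps
`Literature/` sorry-free by stating cited results as named facts `def X : Prop`; this file
discharges four of them). It proves

* `Literature.NumberTheory.Transcendental.multipleZeta_singleton` — `ζ(k) = ∑_{n ≥ 0} (n + 1)^{-k}` for `k ≥ 2` —
  as `multipleZeta_singleton_holds`;
* `Literature.NumberTheory.Transcendental.ofReal_multipleZeta_singleton` — `(ζ(k) : ℂ) = riemannZeta k` for `k ≥ 2` —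
  as `ofReal_multipleZeta_singleton_holds`;
* `Literature.NumberTheory.Transcendental.summable_of_isAdmissible` — the multiple zeta series of an
  admissible index converges — as `summable_of_isAdmissible_holds`;
* `Literature.NumberTheory.Transcendental.multipleZeta_pos_of_isAdmissible` — `0 < ζ(s)` for an
  admissible index `s` — as `multipleZeta_pos_of_isAdmissible_holds`.

Users holding `(h : ofReal_multipleZeta_singleton)` (etc.) are fed the corresponding `_holds` theorem.

## The source and this file

Zagier (First European Congress of Mathematics II, 1994, p. 497, eq. (2)) defines
`ζ(k₁, …, k_r) = ∑_{0 < n₁ < ⋯ < n_r} n₁^{-k₁} ⋯ n_r^{-k_r}` (`k_i ≥ 1`, `k_r ≥ 2`) and calls these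
numbers *multiple zeta values* "since they generalize the classical special values `ζ(k)`"
(§9, p. 509): for `r = 1` the sum (2) is Riemann's `ζ(k) = ∑_{n ≥ 1} n^{-k}` (p. 497), `k ≥ 2`.
The printed summation order is increasing with the *last* exponent `≥ 2`; `Literature.NumberTheory.Transcendental.multipleZeta`
uses the reversed, decreasing order `n₁ > ⋯ > n_k ≥ 1` with the *first* exponent `≥ 2`; in depth
one the two conventions coincide verbatim, so there is nothing to prove on paper. In Lean the
summation domain `Literature.mzvIndexSet 1` (strictly decreasing positive `1`-tuples) is identified with
`ℕ+` (`multipleZeta_singleton_eq_tsum_pnat`, valid for every `k` since both sides take the same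
junk value when the series diverges), after which Mathlib's `tsum_pnat_eq_tsum_succ`,
`tsum_pnat_eq_tsum_of_eq_zero` and `zeta_nat_eq_tsum_of_gt_one` give the two named facts.

**Convergence and positivity.** The condition `k_r ≥ 2` on the exponent attached to the largest
summation variable in eq. (2) (here: the *first* exponent `s₁ ≥ 2` of an admissible index) is the
convergence condition. The Lean proof is the elementary domination argument: on the domain
`n₁ > n₂ > ⋯ > n_k ≥ 1` one has `n₁^{-s₁} ⋯ n_k^{-s_k} ≤ n₁^{-2} n₂^{-1} ⋯ n_k^{-1}
= n₁^{-1} ∏ᵢ nᵢ^{-1} ≤ ∏ᵢ nᵢ^{-(1 + 1/k)}` (since `n₁^{-1} = ∏ᵢ n₁^{-1/k} ≤ ∏ᵢ nᵢ^{-1/k}`), and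
`∏ᵢ nᵢ^{-(1+1/k)}` is summable over all of `ℕ^k` because each factor is a convergent `p`-series
(`Real.summable_nat_rpow_inv`) and finite partial sums over a box factor
(`Finset.sum_prod_piFinset`). Positivity of `ζ(s)` then follows from `Summable.tsum_pos`: all terms
are positive and the domain contains the tuple `nᵢ = k - i`; for the empty index `ζ(∅) = 1`.

## References

* D. Zagier, *Values of zeta functions and their applications*, First European Congress of
  Mathematics (Paris, 1992), Vol. II, Progr. Math. 120, Birkhäuser (1994), 497–512 — p. 497
  eq. (2), §9 p. 509. [ZagierECM1994]
-/

noncomputable section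

open scoped BigOperators

namespace Literature.NumberTheory.Transcendental

/-- The general term of the depth-one series: for `s = [k]` and a `1`-tuple `n`,
`mzvTerm [k] n = (n₀ ^ k)⁻¹`. [folklore] -/
theorem mzvTerm_singleton (k : ℕ) (n : Fin [k].length → ℕ) :
    mzvTerm [k] n = ((n 0 : ℝ) ^ k)⁻¹ := by
  unfold mzvTerm
  simp

/-- Depth one as a series over the positive integers: `ζ(k) = ∑_{n ≥ 1} n^{-k}`, i.e. eq. (2) of
Zagier (ECM 1994, p. 497) with `r = 1`. Valid for every `k : ℕ` (for `k ≤ 1` both sides are the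
`tsum` junk value of the same divergent series): the summation domain `mzvIndexSet 1` of strictly
decreasing positive `1`-tuples is in bijection with `ℕ+` via `n ↦ n₀`.
[cite: ZagierECM1994, p. 497 eq. (2)] -/
theorem multipleZeta_singleton_eq_tsum_pnat (k : ℕ) :
    multipleZeta [k] = ∑' n : ℕ+, 1 / ((n : ℕ) : ℝ) ^ k := by
  let e : mzvIndexSet 1 ≃ ℕ+ :=
    { toFun := fun n => ⟨n.1 0, n.2.2 0⟩
      invFun := fun m => ⟨fun _ => (m : ℕ), Subsingleton.strictAnti _, fun _ => m.pos⟩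
      left_inv := fun n => by ext i; simp [Fin.eq_zero i]
      right_inv := fun _ => rfl }
  rw [← e.tsum_eq]
  unfold multipleZeta
  refine tsum_congr fun n => ?_
  rw [mzvTerm_singleton, one_div]
  rfl

/-- **Depth one** — discharge of the named fact `multipleZeta_singleton`:
`ζ(k) = ∑_{n ≥ 0} (n + 1)^{-k}` for `k ≥ 2` (Zagier, ECM 1994, p. 497, eq. (2) with `r = 1`; the
shift `n ↦ n + 1` is Mathlib's `tsum_pnat_eq_tsum_succ`). [cite: ZagierECM1994, p. 497 eq. (2)] -/
theorem multipleZeta_singleton_holds : multipleZeta_singleton := by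
  intro k hk
  rw [multipleZeta_singleton_eq_tsum_pnat,
    tsum_pnat_eq_tsum_succ (f := fun n => 1 / (n : ℝ) ^ k)]
  push_cast
  rfl

/-- **Depth one is Riemann's `ζ(k)`** — discharge of the named fact
`ofReal_multipleZeta_singleton`: for `k ≥ 2`, `(multipleZeta [k] : ℂ) = riemannZeta k`
(Zagier, ECM 1994, p. 497: eq. (2) with `r = 1` is Riemann's `ζ(k) = ∑_{n ≥ 1} n^{-k}`; §9,
p. 509: the multiple zeta values "generalize the classical special values `ζ(k)`"). The Lean proof
inserts the vanishing `n = 0` term (`tsum_pnat_eq_tsum_of_eq_zero`, using `k ≠ 0`) and compares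
with Mathlib's `zeta_nat_eq_tsum_of_gt_one` (using `1 < k`).
[cite: ZagierECM1994, p. 497 eq. (2) and §9 p. 509] -/
theorem ofReal_multipleZeta_singleton_holds : ofReal_multipleZeta_singleton := by
  intro k hk
  rw [multipleZeta_singleton_eq_tsum_pnat,
    tsum_pnat_eq_tsum_of_eq_zero (f := fun n => 1 / (n : ℝ) ^ k) (by simp; omega),
    Complex.ofReal_tsum, zeta_nat_eq_tsum_of_gt_one hk]
  push_cast
  rfl

/-! ### Convergence of the multiple zeta series and positivity of multiple zeta values -/

/-- If `g ≥ 0` is summable on `ℕ`, then `n ↦ ∏ᵢ g (n i)` is summable on `Fin k → ℕ`: every finite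
partial sum is taken over a box, where it factors as `∏ᵢ ∑_{m < N} g m ≤ (∑ g)^k`. [folklore] -/
theorem summable_pi_fin_prod {k : ℕ} {g : ℕ → ℝ} (hg : Summable g) (hg0 : ∀ m, 0 ≤ g m) :
    Summable fun n : Fin k → ℕ => ∏ i, g (n i) := by
  classical
  refine summable_of_sum_le (c := (∑' m, g m) ^ k)
    (fun n => Finset.prod_nonneg fun i _ => hg0 (n i)) fun u => ?_
  obtain ⟨N, hN⟩ : ∃ N, ∀ n ∈ u, ∀ i, n i < N := by
    refine ⟨u.sup (fun n => Finset.univ.sup n) + 1, fun n hn i => Nat.lt_succ_of_le ?_⟩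
    exact (Finset.le_sup (f := n) (Finset.mem_univ i)).trans
      (Finset.le_sup (f := fun n : Fin k → ℕ => Finset.univ.sup n) hn)
  have hu : u ⊆ Fintype.piFinset fun _ : Fin k => Finset.range N := fun n hn =>
    Fintype.mem_piFinset.2 fun i => Finset.mem_range.2 (hN n hn i)
  calc ∑ n ∈ u, ∏ i, g (n i)
      ≤ ∑ n ∈ Fintype.piFinset fun _ : Fin k => Finset.range N, ∏ i, g (n i) :=
        Finset.sum_le_sum_of_subset_of_nonneg hu fun n _ _ =>
          Finset.prod_nonneg fun i _ => hg0 (n i)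
    _ = ∏ _i : Fin k, ∑ m ∈ Finset.range N, g m :=
        Finset.sum_prod_piFinset (Finset.range N) (fun (_ : Fin k) m => g m)
    _ ≤ ∏ _i : Fin k, ∑' m, g m :=
        Finset.prod_le_prod (fun i _ => Finset.sum_nonneg fun m _ => hg0 m) fun i _ =>
          hg.sum_le_tsum _ fun m _ => hg0 m
    _ = (∑' m, g m) ^ k := by simp

/-- The key estimate behind the convergence of the multiple zeta series: for exponents `e i ≥ 1`
with `e i₀ ≥ 2` and a tuple `1 ≤ n i ≤ n i₀` of `k` positive integers,
`∏ᵢ n_i^{-e_i} ≤ ∏ᵢ n_i^{-(1 + 1/k)}`; indeed `∏ᵢ n_i^{1 + 1/k} ≤ (∏ᵢ n_i) · n_{i₀} ≤ ∏ᵢ n_i^{e_i}`.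
[folklore] -/
theorem prod_pow_inv_le_prod_rpow_inv {k : ℕ} (e n : Fin k → ℕ) (i₀ : Fin k)
    (he : ∀ i, 1 ≤ e i) (he₀ : 2 ≤ e i₀) (hn : ∀ i, 1 ≤ n i) (hN : ∀ i, n i ≤ n i₀) :
    ∏ i, ((n i : ℝ) ^ (e i))⁻¹ ≤ ∏ i, ((n i : ℝ) ^ (1 + (k : ℝ)⁻¹))⁻¹ := by
  have hk : k ≠ 0 := by
    rintro rfl
    exact i₀.elim0
  have hn0 : ∀ i, (0 : ℝ) < n i := fun i => Nat.cast_pos.2 (hn i)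
  have hn1 : ∀ i, (1 : ℝ) ≤ n i := fun i => by exact_mod_cast hn i
  have hA : ∏ i, (n i : ℝ) ^ (1 + (k : ℝ)⁻¹) ≤ (∏ i, (n i : ℝ)) * n i₀ := by
    calc ∏ i, (n i : ℝ) ^ (1 + (k : ℝ)⁻¹) ≤ ∏ i, ((n i : ℝ) * (n i₀ : ℝ) ^ (k : ℝ)⁻¹) := by
          refine Finset.prod_le_prod (fun i _ => Real.rpow_nonneg (hn0 i).le _) fun i _ => ?_
          rw [Real.rpow_add (hn0 i), Real.rpow_one]
          exact mul_le_mul_of_nonneg_left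
            (Real.rpow_le_rpow (hn0 i).le (by exact_mod_cast hN i) (by positivity)) (hn0 i).le
      _ = (∏ i, (n i : ℝ)) * n i₀ := by
          rw [Finset.prod_mul_distrib, Finset.prod_const, Finset.card_univ, Fintype.card_fin,
            Real.rpow_inv_natCast_pow (hn0 i₀).le hk]
  have hB : (∏ i, (n i : ℝ)) * n i₀ ≤ ∏ i, (n i : ℝ) ^ (e i) := by
    calc (∏ i, (n i : ℝ)) * n i₀ = ∏ i, ((n i : ℝ) * if i = i₀ then (n i₀ : ℝ) else 1) := by
          rw [Finset.prod_mul_distrib]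
          simp
      _ ≤ ∏ i, (n i : ℝ) ^ (e i) := by
          refine Finset.prod_le_prod (fun i _ => ?_) fun i _ => ?_
          · split_ifs <;> positivity
          split_ifs with h
          · subst h
            calc (n i : ℝ) * n i = (n i : ℝ) ^ 2 := (sq _).symm
              _ ≤ (n i : ℝ) ^ (e i) := pow_le_pow_right₀ (hn1 i) he₀
          · rw [mul_one]
            calc (n i : ℝ) = (n i : ℝ) ^ 1 := (pow_one _).symm
              _ ≤ (n i : ℝ) ^ (e i) := pow_le_pow_right₀ (hn1 i) (he i)
  rw [Finset.prod_inv_distrib, Finset.prod_inv_distrib]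
  exact inv_anti₀ (Finset.prod_pos fun i _ => Real.rpow_pos_of_pos (hn0 i) _) (hA.trans hB)

/-- The general term of the multiple zeta series is nonnegative. [folklore] -/
theorem mzvTerm_nonneg (s : List ℕ) (n : Fin s.length → ℕ) : 0 ≤ mzvTerm s n :=
  Finset.prod_nonneg fun _ _ => inv_nonneg.2 (pow_nonneg (Nat.cast_nonneg _) _)

/-- The general term of the multiple zeta series is positive on the summation domain. [folklore] -/
theorem mzvTerm_pos {s : List ℕ} {n : Fin s.length → ℕ} (hn : n ∈ mzvIndexSet s.length) :
    0 < mzvTerm s n :=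
  Finset.prod_pos fun i _ => inv_pos.2 (pow_pos (Nat.cast_pos.2 (hn.2 i)) _)

/-- On the summation domain, the general term of an admissible index `s = (s₁, …, s_k)`, `k ≥ 1`,
is dominated by the summable product `∏ᵢ n_i^{-(1 + 1/k)}`. [folklore] -/
theorem mzvTerm_le_prod_rpow_inv {s : List ℕ} (hs : MZV.IsAdmissible s) (hs' : s ≠ [])
    {n : Fin s.length → ℕ} (hn : n ∈ mzvIndexSet s.length) :
    mzvTerm s n ≤ ∏ i, ((n i : ℝ) ^ (1 + (s.length : ℝ)⁻¹))⁻¹ := by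
  have hk : 0 < s.length := List.length_pos_iff.2 hs'
  let i₀ : Fin s.length := ⟨0, hk⟩
  refine prod_pow_inv_le_prod_rpow_inv (fun i => s[i]) n i₀ (fun i => hs.1 _ (List.getElem_mem _))
    ?_ (fun i => hn.2 i) fun i => hn.1.antitone (Fin.mk_le_mk.2 (Nat.zero_le _))
  have h2 := hs.2 hs'
  rw [List.head_eq_getElem] at h2
  simpa [i₀] using h2

/-- **Convergence** — discharge of the named fact `summable_of_isAdmissible`: the multiple zeta
series of an admissible index converges (Zagier, ECM 1994, p. 497, eq. (2): the condition on the
leading exponent "ensures convergence"). Proof: domination by `∏ᵢ n_i^{-(1+1/k)}`, a product of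
convergent `p`-series summed over all of `ℕ^k`. [cite: ZagierECM1994, p. 497 eq. (2)] -/
theorem summable_of_isAdmissible_holds : summable_of_isAdmissible := by
  intro s hs
  rcases s with _ | ⟨a, t⟩
  · show Summable fun n : mzvIndexSet 0 => mzvTerm [] n.1
    exact .of_finite
  · set k := (a :: t).length with hk
    have hk0 : k ≠ 0 := by simp [hk]
    have hp : 1 < 1 + (k : ℝ)⁻¹ := lt_add_of_pos_right _ (by positivity)
    have hg0 : ∀ m : ℕ, 0 ≤ ((m : ℝ) ^ (1 + (k : ℝ)⁻¹))⁻¹ := fun m =>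
      inv_nonneg.2 (Real.rpow_nonneg (Nat.cast_nonneg _) _)
    have hG := (summable_pi_fin_prod (k := k) (Real.summable_nat_rpow_inv.2 hp) hg0).subtype
      (mzvIndexSet k)
    refine Summable.of_nonneg_of_le (fun n => mzvTerm_nonneg _ _) (fun n => ?_) hG
    exact mzvTerm_le_prod_rpow_inv hs (List.cons_ne_nil a t) n.2

/-- **Positivity** — discharge of the named fact `multipleZeta_pos_of_isAdmissible`: the multiple
zeta value of an admissible index is a positive real number, being the sum of a convergent series
of positive terms over a nonempty domain (Zagier, ECM 1994, p. 497, eq. (2); for the empty index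
`ζ(∅) = 1`). The witness tuple is `nᵢ = k - i`. [cite: ZagierECM1994, p. 497 eq. (2)] -/
theorem multipleZeta_pos_of_isAdmissible_holds : multipleZeta_pos_of_isAdmissible := by
  intro s hs
  have hn₀ : (fun i : Fin s.length => s.length - (i : ℕ)) ∈ mzvIndexSet s.length := by
    refine ⟨fun i j hij => ?_, fun i => ?_⟩
    · have hi := i.2
      have hj := j.2
      rw [Fin.lt_def] at hij
      dsimp only
      omega
    · have hi := i.2
      dsimp only
      omega
  unfold multipleZeta
  exact (summable_of_isAdmissible_holds hs).tsum_pos (fun n => mzvTerm_nonneg s n.1) ⟨_, hn₀⟩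
    (mzvTerm_pos hn₀)

end Literature.NumberTheory.Transcendental
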